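import Literature.AlgebraicGeometry.HodgeTheory.HardLefschetzNFold
import Literature.AlgebraicTopology.SingularHomology.CupProductProofs

/-!
# Route LinearSystemTorelli — crux `LocalTubeSpan` (stmt-HodgeConjecture-2490): hard Lefschetz for the class of a member

Helper file (`--supports stmt-HodgeConjecture-2490`, line `Sketch` of the crux chain, cycle 5 wave 2,
companion of the stub `stub_lefschetzSplitting`).

The typed conclusions of the line on the VANISHING local system (files `…TypedAssemblyVanishing`,
`…VanishingTransfer`) carry the Lefschetz splitting `Hⁿ(X_s) = Hⁿ(X_s)_van ⊕ i^*Hⁿ(X)` as the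
hypothesis `IsCompl`; the stub `stub_lefschetzSplitting` derives it from the projection formula and
the bijectivity of `x ↦ x ∪ [X_s] : Hⁿ(X(ℂ); ℂ) → Hⁿ⁺²(X(ℂ); ℂ)` for the class `[X_s] = i_* 1` of the
member.  This file supplies that bijectivity from the tree's HARD LEFSCHETZ package
(`HardLefschetzNFold (n + 1) X`, C. Voisin, *Hodge Theory and Complex Algebraic Geometry I* (2002)
Thm. 6.25; its existence for smooth projective `X` is the tree's `nonempty_hardLefschetzNFold_holds`)
whenever `[X_s]` is a non-zero multiple of the hyperplane class (a member of `|𝒪_X(d)|` has class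
`d·[H]`):

* `localTubeSpan_cup_hyperplaneClass_eq_L` — `x ∪ [H] = L x` (graded commutativity in even degree,
  `cupProduct_gradedComm_holds`, and `Λ.L 1 = [H] ∪ ·`);
* `localTubeSpan_bijective_cup_of_hardLefschetz` — for `cls = c • [H]`, `c ≠ 0`, the map
  `x ↦ x ∪ cls : Hⁿ(X) → Hⁿ⁺²(X)` is bijective (`Λ.bijective_L` with `j = 1`, `k = n`,
  `k + j = n + 1 = dim X`).

No named facts beyond the hypothesis structure `Λ`; no `sorry`.
-/

-- `Summit.HodgeConjecture.HodgeConjecture.Theorems` is the mandated namespace (single-conjunct summit: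
-- Sub = Summit), which `linter.dupNamespace` flags on every declaration; the lakefile turns the
-- linter off tree-wide (weak option), restated here so stand-alone elaboration is warning-free too.
set_option linter.dupNamespace false

noncomputable section

open CategoryTheory
open Literature.AlgebraicGeometry Literature.AlgebraicGeometry.HodgeTheory
open Literature.AlgebraicTopology.SingularHomology Literature.Geometry.Kaehler

namespace Summit.HodgeConjecture.HodgeConjecture.Theorems

variable {X : Motives.SchemeOver ℂ} {n : ℕ}

/-- **`x ∪ [H] = L x`** on `Hⁿ(X(ℂ); ℂ)`: cup product on the RIGHT with the hyperplane class is the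
Lefschetz operator `Λ.L 1 n (n + 2)` (graded commutativity `a ∪ b = (-1)^{pq} b ∪ a` with `q = 2`).
[cite: VoisinHodgeI2002, §6.2.3] -/
theorem localTubeSpan_cup_hyperplaneClass_eq_L (Λ : HardLefschetzNFold (n + 1) X)
    (hn2 : n + 2 = n + 2) (x : complexBetti X n) :
    cupProduct hn2 x Λ.hyperplaneClass = Λ.L 1 n (n + 2) (by omega) x := by
  have h2n : 2 + n = n + 2 := Nat.add_comm 2 n
  rw [cupProduct_gradedComm_holds ℂ (Motives.ComplexPoints X) hn2 h2n x Λ.hyperplaneClass]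
  have hsign : ((-1 : ℂ) ^ (n * 2)) = 1 := by
    rw [mul_comm, pow_mul, neg_one_sq, one_pow]
  · rw [hsign, one_smul, HardLefschetzNFold.L,
      lefschetzPowTo_succ_apply Λ.hyperplaneClass 0 n n (n + 2) rfl (by omega) h2n,
      lefschetzPowTo_zero_apply, lefschetzOperator_apply]

/-- **Hard Lefschetz for the class of a member**: if `cls = c • [H]` with `c ≠ 0` (e.g. the class
`d·[H]` of a member of `|𝒪_X(d)|` on the `(n+1)`-fold `X`), then `x ↦ x ∪ cls : Hⁿ(X(ℂ); ℂ) →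
Hⁿ⁺²(X(ℂ); ℂ)` is bijective — the hypothesis `hHL` of `stub_lefschetzSplitting`.
[cite: VoisinHodgeI2002, Thm. 6.25] -/
theorem localTubeSpan_bijective_cup_of_hardLefschetz (Λ : HardLefschetzNFold (n + 1) X)
    {cls : complexBetti X 2} {c : ℂ} (hc : c ≠ 0) (hcls : cls = c • Λ.hyperplaneClass)
    (hn2 : n + 2 = n + 2) :
    Function.Bijective fun x : complexBetti X n => cupProduct hn2 x cls := by
  have hL : Function.Bijective (Λ.L 1 n (n + 2) (by omega)) :=
    Λ.bijective_L (j := 1) (k := n) (by omega) (n + 2) (by omega)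
  have key : ∀ x : complexBetti X n,
      cupProduct hn2 x cls = c • Λ.L 1 n (n + 2) (by omega) x := fun x => by
    rw [hcls, map_smul, localTubeSpan_cup_hyperplaneClass_eq_L Λ hn2 x]
  constructor
  · intro x y hxy
    have h : c • Λ.L 1 n (n + 2) (by omega) x = c • Λ.L 1 n (n + 2) (by omega) y := by
      rw [← key x, ← key y]; exact hxy
    exact hL.1 (smul_right_injective _ hc h)
  · intro z
    obtain ⟨x, hx⟩ := hL.2 (c⁻¹ • z)
    refine ⟨x, ?_⟩
    change cupProduct hn2 x cls = z
    rw [key x, hx, smul_smul, mul_inv_cancel₀ hc, one_smul]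

end Summit.HodgeConjecture.HodgeConjecture.Theorems

end
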